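import Summits.QuantumFields.QCD.Theses.IntegerCriticalLine
import Summits.QuantumFields.QCD.Theorems.RenormalisedVafaWittenWilsonDiracAccretive
import Literature.Barriers.QuantumFields.WilsonDeterminantSign

/-!
# Route `IntegerCriticalLine` (sub QCD) — support item `TrivialPlateauGap` (stmt-QuantumFields-9694), PROVED

For a unitary colour representation `ρ`, every gauge field `U` on a four-torus, `m ≥ 0`, `r ≥ 0` and every
quark vector `v`: `m²‖v‖² ≤ ‖H v‖²` for the Hermitian Wilson–Dirac operator `H = Γ₅ D_W(U,m,r)`.
Proof: accretivity `m‖v‖² ≤ Re⟨v, D_W v⟩` (the tree's `WilsonDiracAccretive`, landed tonight by width seat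
`ym-line-sfw-p2-w2` g24), Cauchy–Schwarz `Re⟨v, D_W v⟩ ≤ ‖v‖‖D_W v‖`, and `‖Γ₅ w‖ = ‖w‖` (`Γ₅` is the diagonal
sign matrix `spinorLift_gammaFive_eq_diagonal`).  Hence for `m₀ > 0` the spectrum of `H` avoids `(−m₀, m₀)` on the
trivial-insulator side, configuration by configuration.

HONEST FRAMING: a support item (finite-dimensional linear algebra); the route's cruxes and the summit conjunct
`QCD` are untouched. [cite: MontvayMunster1994, §4.2.2 (4.85), §5.1.2 (5.15); EdwardsHellerNarayanan1998, §1]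
-/

set_option autoImplicit false

namespace Summit.QuantumFields.QCD.Theorems.IntegerCriticalLine

open Matrix Finset
open Literature.MathematicalPhysics.QuantumFieldTheory
open Literature.MathematicalPhysics.QuantumLattice
open Literature.Probability.LatticeModels (TorusSite)
open Literature.Barriers.QuantumFields.WilsonDeterminant

/-- `Γ₅` preserves the Euclidean norm of quark vectors: `Σ‖(Γ₅ w)_i‖² = Σ‖w_i‖²`. [folklore] -/
theorem sum_norm_sq_spinorLift_gammaFive_mulVec {L N : ℕ} [NeZero L] (w : TorusSite 4 L × Fin N × Fin 4 → ℂ) :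
    ∑ i, ‖((spinorLift gammaFive : Matrix (TorusSite 4 L × Fin N × Fin 4) (TorusSite 4 L × Fin N × Fin 4) ℂ)
        *ᵥ w) i‖ ^ 2 = ∑ i, ‖w i‖ ^ 2 := by
  rw [spinorLift_gammaFive_eq_diagonal]
  refine Finset.sum_congr rfl fun i _ => ?_
  rw [mulVec_diagonal, norm_mul]
  have h : ‖(![1, 1, -1, -1] : Fin 4 → ℂ) i.2.2‖ = 1 := by
    obtain ⟨x, a, α⟩ := i
    fin_cases α <;> simp
  rw [h, one_mul]

/-- **Cauchy–Schwarz for the real part of a Hermitian form on quark vectors**: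
`(Re Σ conj(v_i) w_i)² ≤ (Σ‖v_i‖²)(Σ‖w_i‖²)`. [folklore] -/
theorem re_sum_star_mul_sq_le {ι : Type*} [Fintype ι] (v w : ι → ℂ) :
    (∑ i, star (v i) * w i).re ^ 2 ≤ (∑ i, ‖v i‖ ^ 2) * ∑ i, ‖w i‖ ^ 2 := by
  have h1 : |(∑ i, star (v i) * w i).re| ≤ ∑ i, ‖v i‖ * ‖w i‖ := by
    calc |(∑ i, star (v i) * w i).re| ≤ ‖∑ i, star (v i) * w i‖ := Complex.abs_re_le_norm _
      _ ≤ ∑ i, ‖star (v i) * w i‖ := norm_sum_le _ _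
      _ = ∑ i, ‖v i‖ * ‖w i‖ := Finset.sum_congr rfl fun i _ => by rw [norm_mul, norm_star]
  have h2 := Finset.sum_mul_sq_le_sq_mul_sq (Finset.univ : Finset ι) (fun i => ‖v i‖) (fun i => ‖w i‖)
  have h3 : (∑ i, star (v i) * w i).re ^ 2 ≤ (∑ i, ‖v i‖ * ‖w i‖) ^ 2 := by
    rw [← sq_abs]
    exact pow_le_pow_left₀ (abs_nonneg _) h1 2
  exact h3.trans h2

/-- The route's support item `TrivialPlateauGap` (stmt-QuantumFields-9694) BY NAME: `m²Σ‖v_i‖² ≤ Σ‖(Γ₅ D_W v)_i‖²`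
for `m, r ≥ 0` and unitary `ρ`. [cite: MontvayMunster1994, §5.1.2 (5.15); EdwardsHellerNarayanan1998, §1] -/
theorem trivialPlateauGap_proof :
    Summit.QuantumFields.QCD.Theses.IntegerCriticalLine.TrivialPlateauGap := by
  intro L N _ G _ ρ hρ U m r hm hr v
  set D := wilsonDirac ρ U m r with hD
  -- accretivity (tree) and Cauchy–Schwarz
  have hacc := Summit.QuantumFields.QCD.Theorems.renormalisedVafaWitten_wilsonDiracAccretive_proof
    L N G ρ hρ U m r hr v
  rw [← hD] at hacc
  have hcs := re_sum_star_mul_sq_le v (D *ᵥ v)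
  -- `H v = Γ₅ (D v)` has the same norm as `D v`
  have hH : ∑ i, ‖(hermitianWilsonDirac ρ U m r *ᵥ v) i‖ ^ 2 = ∑ i, ‖(D *ᵥ v) i‖ ^ 2 := by
    rw [hermitianWilsonDirac, ← mulVec_mulVec, sum_norm_sq_spinorLift_gammaFive_mulVec]
  rw [hH]
  set S : ℝ := ∑ i, ‖v i‖ ^ 2 with hS
  set T : ℝ := ∑ i, ‖(D *ᵥ v) i‖ ^ 2 with hT
  set P : ℝ := (∑ i, star (v i) * (D *ᵥ v) i).re with hP
  have hS0 : 0 ≤ S := Finset.sum_nonneg fun i _ => by positivity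
  have hT0 : 0 ≤ T := Finset.sum_nonneg fun i _ => by positivity
  -- `m S ≤ P`, `P² ≤ S T` ⇒ `m² S ≤ T`
  rcases hS0.eq_or_lt with hS0' | hSpos
  · rw [← hS0']; simpa using hT0
  · have hmS : 0 ≤ m * S := mul_nonneg hm hS0
    have h1 : (m * S) ^ 2 ≤ P ^ 2 := pow_le_pow_left₀ hmS hacc 2
    have h2 : (m * S) ^ 2 ≤ S * T := h1.trans hcs
    nlinarith

end Summit.QuantumFields.QCD.Theorems.IntegerCriticalLine
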